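import Literature.Analysis.FluidPDE.SereginSverak2002PairingModulus
import Literature.Analysis.FluidPDE.LocalTypeI
import HarnessLib

/-!
# Line `extinct-apex` of `TerminalTrace.TypeITraceScarL3`, Stub 2 — tool file 1/3: the slice bound of
# the zoomed pairing identity under a Morrey bound at the vertex ball

Route `TerminalTrace` (NavierStokesRegularity), item `TypeITraceScarL3` (stmt-NavierStokesRegularity-18385),
registered skeleton `extinct-apex` (nsreg-p2 g26, sha16 07e82d2c7e70161a), Stub 2
`stub_extinctApex_of_L3trace` (a Type-I-in-time blow-up with an `L³` terminal ball at a
backward-singular apex zooms to an EXTINCT Type-I apex).  Seat ns-typeII-p3 g9 (cell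
ns-regularity-ideate), helper file `--supports stmt-NavierStokesRegularity-18385`.

The tree proves the weak vanishing of a vertex blow-up limit at its final time in
Seregin–Šverák's ONE-SIDED-PRESSURE setting (`SereginSverak2002.zoom_slice_pairing_bound`,
`….zoom_pairing_modulus`, `….ae_abs_pairing_le_near_top_of_scaledEnergy`); there the pressure sign
serves only to produce (i) a Morrey bound `∫_{B(x₀,ρ)} |u(t)|² ≤ M ρ` near the vertex and (ii) a
scale-invariant `L^{3/2}` bound on the pressure in the vertex cylinders.  The three files
`…ExtinctApexSliceBound`, `…ExtinctApexPairingModulus`, `…ExtinctApexTopVanishing` re-run those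
proofs with (i) and (ii) as HYPOTHESES — (ii) in the mean-free form
`cknDOsc ρ (T, x₀) p ≤ I₀` (the `D` of Albritton–Barker's `𝐈`, exactly what a local Type-I bound
at the apex supplies; `∫ p div φ` does not see the ball mean) — which is the form a Type-I blow-up
delivers (`morrey_of_typeI`, `exists_zoom_typeIBound_lt_top_of_morrey`).

This file (1/3), unit viscosity, `(u, p)` classical on `[0, T) × ℝ³`:

* `zoom_slice_pairing_bound_of_morrey` — at one zoomed time `τ` (`θ = t + R²τ ∈ [0, T)`) with
  `∫_{B(x₀, aR)} |u(θ)|² ≤ M (aR)`: the velocity terms of the pairing identity for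
  `u_R = R u(t + R²·, x₀ + R·)` against `φ ∈ C_c^1(B(0, a))` are `≤ C₁ M a + C₂ (|B(0,a)| + M a)/2`,
  the pressure term `≤ C₃ ∫_{B(0,a)} |R² (p(θ, x₀ + R y) − [p(θ)]_{B(x₀,aR)})| dy`;
* `aestronglyMeasurable_sub_ballMean_slab` — the pressure gauged by its mean over a fixed ball is
  a.e.-strongly measurable on the slab `(0, T) × ℝ³`.

WHAT THIS IS NOT: not NS regularity, not item 18385, not Stub 3 — bookkeeping of
Seregin–Šverák 2002 §4 under Type-I data.  [folklore; cf. SereginSverak2002 §4]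
-/

noncomputable section

set_option linter.dupNamespace false

open MeasureTheory TopologicalSpace Set Function Filter Topology Metric InnerProductSpace Real
open scoped ENNReal NNReal RealInnerProductSpace ContDiff Laplacian

namespace Summit.NavierStokesRegularity.NavierStokesRegularity.Theorems.TypeITraceScarL3

open Literature.Analysis Literature.Analysis.FluidPDE Literature.Analysis.FluidPDE.SereginSverak2002

variable {T : ℝ} {u : ℝ → EuclideanSpace ℝ (Fin 3) → EuclideanSpace ℝ (Fin 3)}
  {p : ℝ → EuclideanSpace ℝ (Fin 3) → ℝ}

/-! ### The slice bound under a Morrey bound at the vertex ball -/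

set_option maxHeartbeats 800000 in
/-- **The slice bound for the zoomed pairing identity, Morrey form.**  At a zoomed time `τ` with
`θ = t + R²τ ∈ [0, T)` and `∫_{B(x₀, aR)} |u(θ)|² ≤ M (aR)`, the velocity terms of the pairing
identity for `u_R = R u(t + R²·, x₀ + R·)` against a test field `φ` supported in `B(0, a)` are
bounded by `C₁ M a + C₂ (|B(0,a)| + M a)/2`, and the pressure term by
`C₃ ∫_{B(0,a)} |R² (p(θ, x₀ + R y) − [p(θ)]_{B(x₀,aR)})| dy` (the ball mean is invisible to
`∫ p div φ`).  The proof is that of `SereginSverak2002.zoom_slice_pairing_bound` with the Morrey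
bound taken as a hypothesis and the pressure gauged by its ball mean. [folklore; cf. SereginSverak2002 §4] -/
theorem zoom_slice_pairing_bound_of_morrey (hsol : IsClassicalNSSolutionOn (Ico 0 T) 1 0 u p)
    (x₀ : EuclideanSpace ℝ (Fin 3)) {φ : EuclideanSpace ℝ (Fin 3) → EuclideanSpace ℝ (Fin 3)} {a : ℝ}
    (hφ1 : ContDiff ℝ 1 φ) (hφc : HasCompactSupport φ)
    (hφa : tsupport φ ⊆ ball (0 : EuclideanSpace ℝ (Fin 3)) a)
    {C₁ C₂ C₃ : ℝ} (hC₁ : ∀ y, ‖fderiv ℝ φ y‖ ≤ C₁) (hC₂ : ∀ y, ‖(Δ φ) y‖ ≤ C₂)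
    (hC₃ : ∀ y, ‖VectorCalculus.divergence φ y‖ ≤ C₃)
    {R t τ M : ℝ} (hR : 0 < R) (hθ : t + R ^ 2 * τ ∈ Ico 0 T)
    (hMθ : ∫ x in ball x₀ (a * R), ‖u (t + R ^ 2 * τ) x‖ ^ 2 ≤ M * (a * R)) :
    ‖((∫ y, (⟪(R • stPull (R ^ 2) R t x₀ u) τ y, convect ((R • stPull (R ^ 2) R t x₀ u) τ) φ y⟫ +
          1 * ⟪(R • stPull (R ^ 2) R t x₀ u) τ y, (Δ φ) y⟫ +
          ⟪(0 : ℝ → EuclideanSpace ℝ (Fin 3) → EuclideanSpace ℝ (Fin 3)) τ y, φ y⟫)) +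
        ∫ y, ((R ^ 2) • stPull (R ^ 2) R t x₀ p) τ y * VectorCalculus.divergence φ y)‖ ≤
      (C₁ * (M * a) + C₂ * ((volume.real (ball (0 : EuclideanSpace ℝ (Fin 3)) a) + M * a) / 2)) +
        C₃ * ∫ y in ball (0 : EuclideanSpace ℝ (Fin 3)) a,
          |((R ^ 2) • stPull (R ^ 2) R t x₀
              (fun t' x => p t' x - ⨍ y' in ball x₀ (a * R), p t' y')) τ y| := by
  -- adapted from Literature/Analysis/FluidPDE/SereginSverak2002PairingModulus.lean
  -- (`SereginSverak2002.zoom_slice_pairing_bound`)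
  have hC₁0 : 0 ≤ C₁ := (norm_nonneg _).trans (hC₁ 0)
  have hC₂0 : 0 ≤ C₂ := (norm_nonneg _).trans (hC₂ 0)
  have hC₃0 : 0 ≤ C₃ := (norm_nonneg _).trans (hC₃ 0)
  set θ : ℝ := t + R ^ 2 * τ with hθdef
  set vτ : EuclideanSpace ℝ (Fin 3) → EuclideanSpace ℝ (Fin 3) := (R • stPull (R ^ 2) R t x₀ u) τ with hvτ
  set m : ℝ := ⨍ y' in ball x₀ (a * R), p θ y' with hm
  set qτ : EuclideanSpace ℝ (Fin 3) → ℝ :=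
    ((R ^ 2) • stPull (R ^ 2) R t x₀ (fun t' x => p t' x - ⨍ y' in ball x₀ (a * R), p t' y')) τ with hqτ
  have hv_apply : ∀ y, vτ y = R • u θ (x₀ + R • y) := fun y => rfl
  have hq_apply : ∀ y, qτ y = R ^ 2 * (p θ (x₀ + R • y) - m) := fun y => rfl
  have hp_apply : ∀ y, ((R ^ 2) • stPull (R ^ 2) R t x₀ p) τ y = R ^ 2 * p θ (x₀ + R • y) := fun y => rfl
  -- the slice `vτ`: continuity and local energy
  have hu : Continuous (u θ) := (hsol.contDiff_velocity hθ).continuous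
  have hvc : Continuous vτ := by
    have : vτ = fun y => R • u θ (x₀ + R • y) := funext hv_apply
    rw [this]; fun_prop
  have hv2 : IntegrableOn (fun y => ‖vτ y‖ ^ 2) (ball (0 : EuclideanSpace ℝ (Fin 3)) a) :=
    ((hvc.norm.pow 2).continuousOn.integrableOn_compact (isCompact_closedBall 0 a)).mono_set ball_subset_closedBall
  have hMor : ∫ y in ball (0 : EuclideanSpace ℝ (Fin 3)) a, ‖vτ y‖ ^ 2 ≤ M * a := by
    have : (fun y => ‖vτ y‖ ^ 2) = fun y => ‖R • u θ (x₀ + R • y)‖ ^ 2 := funext fun y => by rw [hv_apply]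
    rw [this]
    exact setIntegral_ball_norm_sq_space_zoom_le x₀ hR hMθ
  -- the velocity terms
  have hfin : volume (ball (0 : EuclideanSpace ℝ (Fin 3)) a) < ⊤ := measure_ball_lt_top
  have i1 : IntegrableOn (fun _ : EuclideanSpace ℝ (Fin 3) => (1 : ℝ)) (ball (0 : EuclideanSpace ℝ (Fin 3)) a) :=
    integrableOn_const (C := (1 : ℝ)) hfin.ne
  have iA : IntegrableOn (fun y => (1 + ‖vτ y‖ ^ 2) / 2) (ball (0 : EuclideanSpace ℝ (Fin 3)) a) :=
    (i1.add hv2).div_const 2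
  have hH1 : ‖∫ y, (⟪vτ y, convect vτ φ y⟫ + 1 * ⟪vτ y, (Δ φ) y⟫ +
      ⟪(0 : ℝ → EuclideanSpace ℝ (Fin 3) → EuclideanSpace ℝ (Fin 3)) τ y, φ y⟫)‖ ≤
      C₁ * (M * a) + C₂ * ((volume.real (ball (0 : EuclideanSpace ℝ (Fin 3)) a) + M * a) / 2) := by
    have hzero : ∀ y, y ∉ ball (0 : EuclideanSpace ℝ (Fin 3)) a →
        ⟪vτ y, convect vτ φ y⟫ + 1 * ⟪vτ y, (Δ φ) y⟫ +
          ⟪(0 : ℝ → EuclideanSpace ℝ (Fin 3) → EuclideanSpace ℝ (Fin 3)) τ y, φ y⟫ = 0 := by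
      intro y hy
      have h1 : fderiv ℝ φ y = 0 := fderiv_of_notMem_tsupport (𝕜 := ℝ) fun h => hy (hφa h)
      have h2 : (Δ φ) y = 0 := laplacian_eq_zero_of_notMem_tsupport fun h => hy (hφa h)
      simp [convect, h1, h2]
    rw [← setIntegral_eq_integral_of_forall_compl_eq_zero hzero]
    have iB : IntegrableOn (fun y => C₁ * ‖vτ y‖ ^ 2 + C₂ * ((1 + ‖vτ y‖ ^ 2) / 2))
        (ball (0 : EuclideanSpace ℝ (Fin 3)) a) := (hv2.const_mul C₁).add (iA.const_mul C₂)
    refine (norm_integral_le_of_norm_le iB ?_).trans ?_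
    · filter_upwards with y
      rw [Real.norm_eq_abs]
      simp only [Pi.zero_apply, inner_zero_left, add_zero, one_mul]
      have b1 : |⟪vτ y, convect vτ φ y⟫| ≤ C₁ * ‖vτ y‖ ^ 2 := by
        rw [convect]
        calc |⟪vτ y, fderiv ℝ φ y (vτ y)⟫| ≤ ‖vτ y‖ * ‖fderiv ℝ φ y (vτ y)‖ := abs_real_inner_le_norm _ _
          _ ≤ ‖vτ y‖ * (C₁ * ‖vτ y‖) := by
              gcongr
              exact (ContinuousLinearMap.le_opNorm _ _).trans (mul_le_mul_of_nonneg_right (hC₁ y) (norm_nonneg _))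
          _ = C₁ * ‖vτ y‖ ^ 2 := by ring
      have b2 : |⟪vτ y, (Δ φ) y⟫| ≤ C₂ * ((1 + ‖vτ y‖ ^ 2) / 2) := by
        calc |⟪vτ y, (Δ φ) y⟫| ≤ ‖vτ y‖ * ‖(Δ φ) y‖ := abs_real_inner_le_norm _ _
          _ ≤ ((1 + ‖vτ y‖ ^ 2) / 2) * C₂ :=
              mul_le_mul (by nlinarith [sq_nonneg (‖vτ y‖ - 1), norm_nonneg (vτ y)]) (hC₂ y) (norm_nonneg _)
                (by positivity)
          _ = C₂ * ((1 + ‖vτ y‖ ^ 2) / 2) := by ring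
      exact (abs_add_le _ _).trans (add_le_add b1 b2)
    · rw [integral_add (hv2.const_mul C₁) (iA.const_mul C₂), integral_const_mul, integral_const_mul,
        integral_div, integral_add i1 hv2, setIntegral_const, smul_eq_mul, mul_one]
      gcongr
  -- the pressure term, gauged by the ball mean
  have hdc : Continuous fun y => VectorCalculus.divergence φ y := continuous_divergence (hφ1.continuous_fderiv one_ne_zero)
  have hds : HasCompactSupport fun y => VectorCalculus.divergence φ y := by
    refine (hφc.fderiv (𝕜 := ℝ)).mono fun y hy => ?_
    contrapose! hy
    simp only [mem_support, not_not] at hy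
    simp [VectorCalculus.divergence, hy]
  have hp' : Continuous (p θ) := (hsol.contDiff_pressure hθ).continuous
  have hqc : Continuous qτ := by
    have : qτ = fun y => R ^ 2 * (p θ (x₀ + R • y) - m) := funext hq_apply
    rw [this]; fun_prop
  have hqdi : Integrable fun y => qτ y * VectorCalculus.divergence φ y :=
    (hqc.mul hdc).integrable_of_hasCompactSupport hds.mul_left
  have hgauge : ∫ y, ((R ^ 2) • stPull (R ^ 2) R t x₀ p) τ y * VectorCalculus.divergence φ y =
      ∫ y, qτ y * VectorCalculus.divergence φ y := by
    have e : ∀ y, ((R ^ 2) • stPull (R ^ 2) R t x₀ p) τ y = qτ y + R ^ 2 * m := by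
      intro y; rw [hp_apply, hq_apply]; ring
    simp_rw [e]
    exact integral_add_const_mul_divergence _ hφ1 hφc hqdi
  have hH2 : ‖∫ y, ((R ^ 2) • stPull (R ^ 2) R t x₀ p) τ y * VectorCalculus.divergence φ y‖ ≤
      C₃ * ∫ y in ball (0 : EuclideanSpace ℝ (Fin 3)) a, |qτ y| := by
    rw [hgauge]
    have hzero : ∀ y, y ∉ ball (0 : EuclideanSpace ℝ (Fin 3)) a → qτ y * VectorCalculus.divergence φ y = 0 := by
      intro y hy
      have : VectorCalculus.divergence φ y = 0 := by
        simp [VectorCalculus.divergence, fderiv_of_notMem_tsupport (𝕜 := ℝ) fun h => hy (hφa h)]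
      rw [this, mul_zero]
    rw [← setIntegral_eq_integral_of_forall_compl_eq_zero hzero]
    have hint : IntegrableOn (fun y => C₃ * |qτ y|) (ball (0 : EuclideanSpace ℝ (Fin 3)) a) :=
      ((hqc.abs.continuousOn.integrableOn_compact (isCompact_closedBall 0 a)).mono_set ball_subset_closedBall).const_mul C₃
    refine (norm_integral_le_of_norm_le hint ?_).trans (le_of_eq ?_)
    · filter_upwards with y
      rw [Real.norm_eq_abs, abs_mul, mul_comm]
      exact mul_le_mul ((le_of_eq (Real.norm_eq_abs _).symm).trans (hC₃ y)) le_rfl (abs_nonneg _) hC₃0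
    · rw [integral_const_mul]
  exact (norm_add_le _ _).trans (add_le_add hH1 hH2)

/-! ### The pressure gauged by its ball mean is measurable on the slab -/

/-- The pressure of a classical solution on `[0, T)`, gauged by its mean over a fixed ball,
`(t, x) ↦ p(t, x) − ⨍_{B(x₀, r)} p(t, ·)`, is a.e.-strongly measurable on the slab `(0, T) × ℝ³`
(joint continuity of `p` below `T`; the mean is a parametric integral, Fubini). [folklore] -/
theorem aestronglyMeasurable_sub_ballMean_slab (hsol : IsClassicalNSSolutionOn (Ico 0 T) 1 0 u p)
    (x₀ : EuclideanSpace ℝ (Fin 3)) (r : ℝ) :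
    AEStronglyMeasurable
      (uncurry fun t' x => p t' x - ⨍ y' in ball x₀ r, p t' y')
      (volume.restrict (Ioo 0 T ×ˢ (univ : Set (EuclideanSpace ℝ (Fin 3))))) := by
  have hcont : ContinuousOn (uncurry p) (Ico 0 T ×ˢ (univ : Set (EuclideanSpace ℝ (Fin 3)))) :=
    hsol.smooth_pressure.continuousOn
  have hp : AEStronglyMeasurable (fun z : ℝ × EuclideanSpace ℝ (Fin 3) => p z.1 z.2)
      (volume.restrict (Ioo 0 T ×ˢ (univ : Set (EuclideanSpace ℝ (Fin 3))))) :=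
    (hcont.mono (prod_mono Ioo_subset_Ico_self subset_rfl)).aestronglyMeasurable
      (measurableSet_Ioo.prod MeasurableSet.univ)
  -- the mean as a function of time
  have hprod : ∀ B : Set (EuclideanSpace ℝ (Fin 3)),
      (volume.restrict (Ioo 0 T ×ˢ B) : Measure (ℝ × EuclideanSpace ℝ (Fin 3))) =
        (volume.restrict (Ioo 0 T)).prod (volume.restrict B) := fun B => by
    rw [Measure.prod_restrict, ← Measure.volume_eq_prod]
  have hpB : AEStronglyMeasurable (uncurry p)
      ((volume.restrict (Ioo 0 T)).prod (volume.restrict (ball x₀ r))) := by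
    rw [← hprod]
    exact (hcont.mono (prod_mono Ioo_subset_Ico_self (subset_univ _))).aestronglyMeasurable
      (measurableSet_Ioo.prod measurableSet_ball)
  have hI := hpB.integral_prod_right'
  simp only [uncurry_apply_pair] at hI
  have hmean : AEStronglyMeasurable (fun t' => ⨍ y' in ball x₀ r, p t' y')
      (volume.restrict (Ioo 0 T)) := by
    have e : (fun t' => ⨍ y' in ball x₀ r, p t' y') =
        fun t' => (volume.real (ball x₀ r))⁻¹ • ∫ y', p t' y' ∂(volume.restrict (ball x₀ r)) := by
      funext t'
      rw [setAverage_eq]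
    rw [e]
    exact (aestronglyMeasurable_const (b := (volume.real (ball x₀ r))⁻¹)).smul hI
  have hmean2 : AEStronglyMeasurable (fun z : ℝ × EuclideanSpace ℝ (Fin 3) => ⨍ y' in ball x₀ r, p z.1 y')
      (volume.restrict (Ioo 0 T ×ˢ (univ : Set (EuclideanSpace ℝ (Fin 3))))) := by
    rw [hprod]
    exact hmean.comp_quasiMeasurePreserving (Measure.quasiMeasurePreserving_fst
      (μ := volume.restrict (Ioo 0 T)) (ν := volume.restrict (univ : Set (EuclideanSpace ℝ (Fin 3)))))
  exact hp.sub hmean2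



end Summit.NavierStokesRegularity.NavierStokesRegularity.Theorems.TypeITraceScarL3

end
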